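import Mathlib
import HarnessLib
import Summits.QuantumFields.YangMills.Theses.ScalingWindowSplit
import Summits.QuantumFields.YangMills.Theorems.ScalingWindowSplitExistenceLegFromLattice

/-!
# `SelfNormalisedMomentBounds` (stmt-QuantumFields-18929) — negative lemma: ONE DECORRELATION RATE

Negative lemma (refuter, crux attack at birth) for crux U = `ScalingWindowSplit.SelfNormalisedMomentBounds` of
route `ScalingWindowSplit`.

**Finding.**  U quantifies over ALL Schwartz bumps `u` (no `tsupport u ⊆ {x⁰ < 0}` — the clause W₁
`GapAtCorrelationLength` and W₂ `SelfNormalisedSkewness` carry it, U does not).  Already at order `n ≤ 2`, U forces a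
RATE RIGIDITY of the bare truncated plaquette two-point functions along every admissible scheme
(`rate_rigidity_of_selfNormalisedMomentBounds`): for every reflected pair `(v, θv)` with disjoint supports,
`|T⁰_k(v, θv)| ≤ B · T⁰_k(u, θu)` eventually — no disjoint reflected pair may decorrelate more slowly than the reference
pair.  Hence (`SelfNormalisedMomentBounds_false_of_TwoRateWindowScheme`) U is false as soon as ONE admissible
"two-rate" scheme exists (`TwoRateWindowScheme`, the hypothesis `H` of this negative lemma).

**Why `H` is expected (and why it is not constructible here).**  Without the past-support clause the WINDOW
`T⁰_k(u,θu) ≤ M · T⁰_k(τ₋₁u, θτ₋₁u)` can be met PERVERSELY: take `u := τ₊₁ w` with `w` a `θ`-symmetric bump straddling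
`x⁰ = 0`; then `τ₋₁u = w` overlaps its own reflection and `T⁰_k(w, θw) = Var(Φ⁰_k(w))` is ultraviolet-dominated
(`≍ a_k⁴/β_k²` in the Gaussian regime), while `T⁰_k(u, θu)` is an honest pair at physical separation `≈ 3/2`; the window
then holds with `M = 1` WHATEVER the physical mass `m_k = 1/(a_k ξ(β_k))` does, and the floor `a_k^p ≤ T⁰_k(u,θu)`
(`≍ a_k⁸ β_k⁻² e^{-3 m_k/2}`) lets `m_k → ∞` slowly (`m_k ≤ c · log a_k⁻¹`) — the COLLAPSING WINDOW the route's own junk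
analysis identifies as fatal for U.  On such a scheme a closer reflected pair `(v, θv)` (separation `1/2`, say) has
`T⁰_k(v,θv)/T⁰_k(u,θu) ≍ e^{+m_k} → ∞`: this is `H`.  Inhabiting `H` needs a compact `G` whose weak-coupling 4-d Wilson
theory has a FINITE, DIVERGING correlation length with two-sided (Ornstein–Zernike-type) control of plaquette
correlations: abelian connected `G` are massless at weak coupling (Guth 1980, Fröhlich–Spencer 1982), finite `G` freeze
(`ξ → 0`, the floor fails), and for non-abelian connected `G` it is the weak-coupling lattice mass-gap problem
(Chatterjee) — not constructible in the tree.  With the past-support clause restored (`C′` below) `τ₋₁u` is an honest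
pair two units further apart, the window caps `m_k` (spectral representation) and the perverse schemes disappear.

**Repair proposed to the planner (class: misstated on paper).**
`C′`: insert `tsupport u ⊆ {y : E | y 0 < 0} →` before the floor-and-window hypothesis of U (exactly W₂'s clause);
the landed glue `existenceLegFromLattice_proof` then reads `hU G r sch u p M hw hpv hu hfw`.

Contents: `trunc_smul` (bilinearity of the bare truncated two-point function), `rate_rigidity_of_selfNormalisedMomentBounds`
(U ⇒ one rate), `TwoRateWindowScheme` (`H`), `SelfNormalisedMomentBounds_false_of_TwoRateWindowScheme` (`H → ¬U`).
No `sorry`; axioms `propext`, `Classical.choice`, `Quot.sound`.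
-/

noncomputable section

open scoped SchwartzMap BigOperators Topology
open MeasureTheory ProbabilityTheory Filter Topology
open Literature.MathematicalPhysics.AQFT Literature.MathematicalPhysics.QuantumLattice
open Literature.MathematicalPhysics.QuantumFieldTheory
open Summit.QuantumFields.YangMills.Cruxes.HypercubicLimit.CouplingResponse
open Summit.QuantumFields.YangMills.Theorems.ScalingWindowSplit (trunc_rescale trunc_eq_covariance)

namespace Summit.QuantumFields.YangMills.Theorems.SelfNormalisedMomentBounds.Negative

variable {G : Type} [Group G] [TopologicalSpace G] [IsTopologicalGroup G] [CompactSpace G]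
  [MeasurableSpace G] [BorelSpace G]

/-- **Bilinearity of the truncated lattice two-point function** of the curvature under real scalars, for any scheme
`S`: `T_S(a f, b g) = a b · T_S(f, g)` (the truncated function is a covariance of fields linear in the test function).
[cite: GlimmJaffe1987, §6.1 and §19.1] -/
theorem trunc_smul (r : LatticeRep G) (S : SpeciesScheme (YMSpecies G)) (k : ℕ) (a b : ℝ)
    (f g : 𝓢(EuclideanSpace ℝ (Fin 4), ℝ)) :
    latticeSchwinger r.ρ S (fun s => s.F) k (1 + 1) (fun _ => r.curvature) ![a • f, b • g] -
        latticeSchwinger r.ρ S (fun s => s.F) k 1 (fun _ => r.curvature) ![a • f] *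
          latticeSchwinger r.ρ S (fun s => s.F) k 1 (fun _ => r.curvature) ![b • g] =
      a * b *
        (latticeSchwinger r.ρ S (fun s => s.F) k (1 + 1) (fun _ => r.curvature) ![f, g] -
          latticeSchwinger r.ρ S (fun s => s.F) k 1 (fun _ => r.curvature) ![f] *
            latticeSchwinger r.ρ S (fun s => s.F) k 1 (fun _ => r.curvature) ![g]) := by
  rw [trunc_eq_covariance, trunc_eq_covariance]
  simp_rw [smearedLatticeField_smul]
  rw [covariance_const_mul_left, covariance_const_mul_right, mul_assoc]

/-- **U forces ONE decorrelation rate.**  If `SelfNormalisedMomentBounds` holds then, at every admissible datum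
`(G, r, sch, u, p, M)` of U (weak coupling, polynomial volumes, floor and window at `u`) and for every real test `v`
whose support is disjoint from that of `θv`, the bare truncated two-point function of the reflected pair `(v, θv)` is
eventually dominated by that of the reference pair: `|T⁰_k(v,θv)| ≤ B · T⁰_k(u,θu)`.  Proof: the self-normalised
scheme `canon` has `c'_k² = 1/T⁰_k(u,θu)` on the tail; U at orders `1` and `2` (through the landed
`uniformMomentBounds_of_planes`) bounds `|𝔖₂^canon(λv ⊗ λ'θv)|` and `|𝔖₁^canon|` uniformly in `k`, and the seam identity
(`trunc_rescale`, `trunc_smul`) reads `𝔖₂^canon − 𝔖₁^canon 𝔖₁^canon = λλ' T⁰_k(v,θv)/T⁰_k(u,θu)`. [folklore] -/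
theorem rate_rigidity_of_selfNormalisedMomentBounds
    (hU : Summit.QuantumFields.YangMills.Theses.ScalingWindowSplit.SelfNormalisedMomentBounds)
    (r : LatticeRep G) (sch : SpeciesScheme (YMSpecies G))
    (u v : 𝓢(EuclideanSpace ℝ (Fin 4), ℝ)) (p : ℕ) (M : ℝ) :
    let bare : SpeciesScheme (YMSpecies G) := { sch with c := fun _ _ => 1, m := fun _ _ => 0 }
    let T : 𝓢(EuclideanSpace ℝ (Fin 4), ℝ) → ℕ → ℝ := fun w k =>
      latticeSchwinger r.ρ bare (fun s => s.F) k (1 + 1) (fun _ => r.curvature) ![w, thetaTest 4 w] -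
        latticeSchwinger r.ρ bare (fun s => s.F) k 1 (fun _ => r.curvature) ![w] *
          latticeSchwinger r.ρ bare (fun s => s.F) k 1 (fun _ => r.curvature) ![thetaTest 4 w]
    sch.HasWeakCouplingLimit →
    (∃ N : ℕ, 1 ≤ N ∧ ∀ᶠ k in Filter.atTop, (sch.a k)⁻¹ ≤ (sch.a k * (sch.L k : ℝ)) ^ N) →
    (∀ᶠ k in Filter.atTop, (sch.a k) ^ p ≤ T u k ∧ T u k ≤ M * T (timeShiftTest 4 (-1) u) k) →
    Disjoint (tsupport v) (tsupport (thetaTest 4 v)) →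
    ∃ B : ℝ, ∀ᶠ k in Filter.atTop, |T v k| ≤ B * T u k := by
  intro bare T hw hpv hfw hdisj
  -- the self-normalised scheme of U
  let canon : SpeciesScheme (YMSpecies G) :=
    { sch with
      c := fun _ k => (Real.sqrt (T u k))⁻¹
      m := fun _ k => ∫ U, r.curvature.F (torusLift (sch.side k) U) ∂(wilsonMeasure r.ρ (sch.β k)) }
  -- U at the datum: the (inlined) plane-resolved moment bounds of `canon`, re-folded by `Iff.rfl`
  have hP : UniformMomentBoundsPlanes r canon := hU G r sch u p M hw hpv hfw
  -- planes ⇒ curvature strings (landed)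
  obtain ⟨s, C₀, C₁, hb⟩ := uniformMomentBounds_of_planes G r canon hP
  -- the normalised reflected pair
  set N₁ : ℝ := schwartzNorm s (ofRealTest v) with hN₁
  set N₂ : ℝ := schwartzNorm s (ofRealTest (thetaTest 4 v)) with hN₂
  have hN₁0 : 0 ≤ N₁ := schwartzNorm_nonneg _ _
  have hN₂0 : 0 ≤ N₂ := schwartzNorm_nonneg _ _
  set l₁ : ℝ := (N₁ + 1)⁻¹ with hl₁
  set l₂ : ℝ := (N₂ + 1)⁻¹ with hl₂
  have hl₁0 : 0 < l₁ := inv_pos.2 (by linarith)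
  have hl₂0 : 0 < l₂ := inv_pos.2 (by linarith)
  set v₁ : 𝓢(EuclideanSpace ℝ (Fin 4), ℝ) := l₁ • v with hv₁
  set v₂ : 𝓢(EuclideanSpace ℝ (Fin 4), ℝ) := l₂ • thetaTest 4 v with hv₂
  have hn₁ : schwartzNorm s (ofRealTest v₁) ≤ 1 := by
    rw [hv₁, schwartzNorm_ofRealTest_smul, abs_of_pos hl₁0, ← hN₁, hl₁]
    rw [inv_mul_le_iff₀ (by linarith : (0 : ℝ) < N₁ + 1)]
    linarith
  have hn₂ : schwartzNorm s (ofRealTest v₂) ≤ 1 := by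
    rw [hv₂, schwartzNorm_ofRealTest_smul, abs_of_pos hl₂0, ← hN₂, hl₂]
    rw [inv_mul_le_iff₀ (by linarith : (0 : ℝ) < N₂ + 1)]
    linarith
  have hd₁₂ : Disjoint (tsupport (v₁ : EuclideanSpace ℝ (Fin 4) → ℝ))
      (tsupport (v₂ : EuclideanSpace ℝ (Fin 4) → ℝ)) :=
    hdisj.mono (tsupport_smul_subset_right (fun _ => l₁) _) (tsupport_smul_subset_right (fun _ => l₂) _)
  -- U at orders two and one
  have h2 := fun k => hb (1 + 1) ![v₁, v₂]
    (by
      intro i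
      fin_cases i
      · simpa using hn₁
      · simpa using hn₂)
    (by
      intro i j hij
      fin_cases i <;> fin_cases j
      · exact absurd rfl hij
      · simpa using hd₁₂
      · simpa using hd₁₂.symm
      · exact absurd rfl hij) k
  have h1 := fun k => hb 1 ![v₁] (by intro i; fin_cases i; simpa using hn₁)
    (by intro i j hij; exact absurd (Subsingleton.elim i j) hij) k
  have h1' := fun k => hb 1 ![v₂] (by intro i; fin_cases i; simpa using hn₂)
    (by intro i j hij; exact absurd (Subsingleton.elim i j) hij) k
  -- the seam: `𝔖₂^canon − 𝔖₁^canon 𝔖₁^canon = c'_k² · l₁ l₂ · T⁰_k(v, θv)`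
  have hseam : ∀ k,
      latticeSchwinger r.ρ canon (fun s => s.F) k (1 + 1) (fun _ => r.curvature) ![v₁, v₂] -
          latticeSchwinger r.ρ canon (fun s => s.F) k 1 (fun _ => r.curvature) ![v₁] *
            latticeSchwinger r.ρ canon (fun s => s.F) k 1 (fun _ => r.curvature) ![v₂] =
        canon.c r.curvature k ^ 2 * (l₁ * l₂ * T v k) := by
    intro k
    rw [trunc_rescale r canon k v₁ v₂, hv₁, hv₂, trunc_smul]
  -- the uniform bound on the tail
  set A₁ : ℝ := C₀ * C₁ ^ 1 * (Nat.factorial 1 : ℕ) with hA₁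
  set A₂ : ℝ := C₀ * C₁ ^ (1 + 1) * (Nat.factorial (1 + 1) : ℕ) with hA₂
  set B₀ : ℝ := A₂ + A₁ * A₁ with hB₀
  refine ⟨B₀ / (l₁ * l₂), hfw.mono fun k hk => ?_⟩
  have hTpos : 0 < T u k := (pow_pos (sch.a_pos k) p).trans_le hk.1
  have hc : canon.c r.curvature k ^ 2 = (T u k)⁻¹ := by
    show ((Real.sqrt (T u k))⁻¹) ^ 2 = (T u k)⁻¹
    rw [inv_pow, Real.sq_sqrt hTpos.le]
  have hA₁0 : 0 ≤ A₁ := (abs_nonneg _).trans (h1 k)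
  -- |𝔖₂ − 𝔖₁𝔖₁| ≤ A₂ + A₁²
  have hkey : |(T u k)⁻¹ * (l₁ * l₂ * T v k)| ≤ B₀ := by
    rw [← hc, ← hseam k]
    refine (abs_sub _ _).trans (add_le_add (h2 k) ?_)
    rw [abs_mul]
    exact mul_le_mul (h1 k) (h1' k) (abs_nonneg _) hA₁0
  rw [abs_mul, abs_mul, abs_of_pos (inv_pos.2 hTpos), abs_of_pos (mul_pos hl₁0 hl₂0)] at hkey
  -- unwind: |T v k| ≤ (B₀ / (l₁ l₂)) · T u k
  have hll : 0 < l₁ * l₂ := mul_pos hl₁0 hl₂0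
  rw [div_mul_eq_mul_div, le_div_iff₀ hll]
  have := mul_le_mul_of_nonneg_left hkey hTpos.le
  calc |T v k| * (l₁ * l₂) = T u k * ((T u k)⁻¹ * (l₁ * l₂ * |T v k|)) := by
        field_simp
    _ ≤ T u k * B₀ := this
    _ = B₀ * T u k := mul_comm _ _

/-- **`H` — a TWO-RATE WINDOW SCHEME** (hypothesis of the negative lemma; not constructible in the tree).  Some compact
group `G`, faithful `r`, Wilson scheme `sch`, bump `u`, `p`, `M` meet EXACTLY the four hypotheses of U (weak coupling,
polynomial volumes, polynomial floor and window at `u` — `u` NOT required to be supported at negative times), and some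
real test `v` with `tsupport v ∩ tsupport θv = ∅` has its bare truncated reflected two-point function INFINITELY OFTEN
LARGER THAN ANY MULTIPLE of the reference one: `∀ B, ∃ᶠ k, B · T⁰_k(u,θu) < |T⁰_k(v,θv)|` (two decorrelation rates along
one admissible scheme).  Expected from a perversely-windowed collapsing-window scheme (`u = τ₊₁w`, `w` straddling
`x⁰ = 0`, physical mass `m_k → ∞` slowly) of any compact `G` whose weak-coupling 4-d Wilson theory has a finite,
diverging correlation length with two-sided Ornstein–Zernike control — for non-abelian connected `G` the weak-coupling
lattice mass-gap problem (Chatterjee's open problems; abelian `G`: Guth 1980, Fröhlich–Spencer 1982).  A HYPOTHESIS of this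
negative lemma (no citation tag on purpose: it is not a literature fact and must stay in this file). -/
def TwoRateWindowScheme : Prop :=
  ∃ (G : Type) (_ : Group G) (_ : TopologicalSpace G) (_ : IsTopologicalGroup G) (_ : CompactSpace G)
    (_ : MeasurableSpace G) (_ : BorelSpace G) (r : LatticeRep G) (sch : SpeciesScheme (YMSpecies G))
    (u v : 𝓢(EuclideanSpace ℝ (Fin 4), ℝ)) (p : ℕ) (M : ℝ),
    let bare : SpeciesScheme (YMSpecies G) := { sch with c := fun _ _ => 1, m := fun _ _ => 0 }
    let T : 𝓢(EuclideanSpace ℝ (Fin 4), ℝ) → ℕ → ℝ := fun w k =>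
      latticeSchwinger r.ρ bare (fun s => s.F) k (1 + 1) (fun _ => r.curvature) ![w, thetaTest 4 w] -
        latticeSchwinger r.ρ bare (fun s => s.F) k 1 (fun _ => r.curvature) ![w] *
          latticeSchwinger r.ρ bare (fun s => s.F) k 1 (fun _ => r.curvature) ![thetaTest 4 w]
    sch.HasWeakCouplingLimit ∧
    (∃ N : ℕ, 1 ≤ N ∧ ∀ᶠ k in Filter.atTop, (sch.a k)⁻¹ ≤ (sch.a k * (sch.L k : ℝ)) ^ N) ∧
    (∀ᶠ k in Filter.atTop, (sch.a k) ^ p ≤ T u k ∧ T u k ≤ M * T (timeShiftTest 4 (-1) u) k) ∧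
    Disjoint (tsupport v) (tsupport (thetaTest 4 v)) ∧
    ∀ B : ℝ, ∃ᶠ k in Filter.atTop, B * T u k < |T v k|

/-- **Negative lemma modulo `H`: a two-rate window scheme refutes U as typed.**
`TwoRateWindowScheme → ¬ SelfNormalisedMomentBounds`: at the datum of `H`, U's rate rigidity
(`rate_rigidity_of_selfNormalisedMomentBounds`) gives `|T⁰_k(v,θv)| ≤ B · T⁰_k(u,θu)` eventually, contradicting the
second rate `B · T⁰_k(u,θu) < |T⁰_k(v,θv)|` infinitely often.  Class (on paper): refuted-misstated — the repaired
statement `C′` adds `tsupport u ⊆ {y | y 0 < 0} →` (W₂'s clause); the perverse-window witness pattern behind `H` does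
not meet `C′`'s honest window. [folklore] -/
theorem SelfNormalisedMomentBounds_false_of_TwoRateWindowScheme :
    TwoRateWindowScheme →
      ¬ Summit.QuantumFields.YangMills.Theses.ScalingWindowSplit.SelfNormalisedMomentBounds := by
  rintro ⟨G, _, _, _, _, _, _, r, sch, u, v, p, M, hw, hpv, hfw, hdisj, hrate⟩ hU
  obtain ⟨B, hB⟩ := rate_rigidity_of_selfNormalisedMomentBounds hU r sch u v p M hw hpv hfw hdisj
  obtain ⟨k, hk₁, hk₂⟩ := ((hrate B).and_eventually hB).exists
  exact absurd hk₁ (not_lt.2 hk₂)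

end Summit.QuantumFields.YangMills.Theorems.SelfNormalisedMomentBounds.Negative

end
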